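import Mathlib
import Literature.NumberTheory.FaltingsSerre.ExtensionGroupsS3wrS2Meaning

/-!
# ω-census (abelian STPP census): bitmask sets modulo `p` for KERNEL checkers — raw `Nat` primitives and their meaning (tool file)

HONEST FRAMING (pub-omega census; verbatim): lottery ticket; floor = certified bounds/negative ranges.
Census STRUCTURE (seat pub-omega-stpp-1 gen 32, 2026-08-28), family (b2).  The exact-cover / slack-2 partition checkers of the census run by
`decide +kernel`; measured on the slack-2 case-A enumerator for `{(3,3,3),(3,3,4)} @ ℤ₆₁` (HOME `pub-omega-stpp-1-g32/SLACK2-DESIGN.md` §KERNEL PRICING,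
work files `lean/s2enum/`): a subset of `ℤ/p` kept as a `List ℕ` with `List.elem` costs `58 s` of kernel time for the SMALLEST configuration family,
the same search with subsets kept as `Nat` BITMASKS and the RAW primitives `Nat.land / Nat.lor / Nat.xor / Nat.shiftLeft / Nat.shiftRight / Nat.beq / Nat.ble`
(GMP-accelerated by the kernel; the notation type-class layers cost a further factor ≈ 2) runs in `3 s`, whole 50-shape chunks in `30–45 s`.
(Measured: the bit operations may be written with the notations `&&& ||| ^^^ <<< >>>` at no cost; what must be avoided are `List.elem` sets, `if … then` on
`Prop` instances and `==` — use `cond`, `Nat.beq`, `Nat.ble`.)  This file fixes the primitives and proves what they MEAN (against `Nat.testBit`):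
* `maskOf l` (the set of a list), `tb m i` (membership), `fullMask p = 2^p − 1`, `rot p m q` (translation by `+q` modulo `p`), `popc is m`, `members is m`,
  `disjB m n` (disjointness test);
* `tb_eq_testBit`, `tb_maskOf` (`tb (maskOf l) x ↔ x ∈ l`), `maskOf_lt_two_pow`, `tb_land / tb_lor / tb_xor`, `disjB_eq_true_iff`, `tb_fullMask`,
  `tb_compl` (complement inside the low `p` bits), `tb_rot` (`i < p ⇒ tb (rot p m q) i = tb m ((i + p − q) % p)` for `m < 2^p`, `q ≤ p`), `rot_lt_two_pow`,
  `popc_eq_length_filter`, `mem_members`.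
UNCONDITIONAL; no `decide`.  Nothing here is progress on `ω`.

References: H. S. Warren, Hacker's Delight (2002), §2-1 (bit sets as words); H. Cohn, R. Kleinberg, B. Szegedy, C. Umans, FOCS 2005, Def. 5.1 (the use).
-/

namespace Summit.MatrixMultiplication.OmegaCensus.CubeNB.Bits

/-! ## §1 The primitives -/

/-- The bitmask of a list of naturals: bit `x` set for every `x ∈ l`. [folklore] -/
def maskOf (l : List ℕ) : ℕ := l.foldl (fun m x => m ||| (1 <<< x)) 0

/-- Bit test `x ∈ m`. [folklore] -/
def tb (m i : ℕ) : Bool := Nat.beq ((m >>> i) &&& 1) 1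

/-- The full mask `2^p − 1` of `ℤ/p`. [folklore] -/
def fullMask (p : ℕ) : ℕ := (1 <<< p) - 1

/-- Translation of a subset of `ℤ/p` by `+q` (`q ≤ p`): rotation of the low `p` bits. [folklore] -/
def rot (p : ℕ) (m q : ℕ) : ℕ := ((m <<< q) ||| (m >>> (p - q))) &&& fullMask p

/-- Number of members among the positions `is` (use `is = List.range p`). [folklore] -/
def popc (is : List ℕ) (m : ℕ) : ℕ := is.foldl (fun n i => cond (tb m i) (n + 1) n) 0

/-- The members among the positions `is`, in the order of `is`. [folklore] -/
def members (is : List ℕ) (m : ℕ) : List ℕ := is.filter fun i => tb m i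

/-- Disjointness test of two bitmasks. [folklore] -/
def disjB (m n : ℕ) : Bool := Nat.beq (m &&& n) 0

/-! ## §2 Meaning -/

/-- **`tb` is `Nat.testBit`.** [folklore] -/
theorem tb_eq_testBit (m i : ℕ) : tb m i = m.testBit i := by
  rw [Bool.eq_iff_iff, tb, Nat.beq_eq, Nat.and_one_is_mod, Nat.shiftRight_eq_div_pow,
    Nat.testBit_eq_decide_div_mod_eq, decide_eq_true_eq]

/-- **Meaning of `maskOf`**: bit `x` of `maskOf l` is set iff `x ∈ l` (the fold lemma is the tree's
`Literature.NumberTheory.FaltingsSerre.GSp4F2.ExtS3wrS2.testBit_foldl_bit`, reused). [folklore] -/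
theorem testBit_maskOf (l : List ℕ) (x : ℕ) : (maskOf l).testBit x = true ↔ x ∈ l := by
  rw [maskOf, Literature.NumberTheory.FaltingsSerre.GSp4F2.ExtS3wrS2.testBit_foldl_bit]; simp

/-- `tb (maskOf l) x ↔ x ∈ l`. [folklore] -/
theorem tb_maskOf (l : List ℕ) (x : ℕ) : tb (maskOf l) x = true ↔ x ∈ l := by
  rw [tb_eq_testBit, testBit_maskOf]

/-- A mask of residues `< p` is `< 2^p`. [folklore] -/
theorem maskOf_lt_two_pow {l : List ℕ} {p : ℕ} (h : ∀ x ∈ l, x < p) : maskOf l < 2 ^ p := by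
  refine Nat.lt_pow_two_of_testBit _ fun i hi => ?_
  rcases hb : (maskOf l).testBit i with _ | _
  · rfl
  · exact absurd (h i ((testBit_maskOf l i).1 hb)) (by omega)

/-- `tb` of a conjunction. [folklore] -/
theorem tb_land (m n i : ℕ) : tb (m &&& n) i = (tb m i && tb n i) := by
  simp only [tb_eq_testBit, Nat.testBit_and]

/-- `tb` of a disjunction. [folklore] -/
theorem tb_lor (m n i : ℕ) : tb (m ||| n) i = (tb m i || tb n i) := by
  simp only [tb_eq_testBit, Nat.testBit_or]

/-- `tb` of an exclusive or. [folklore] -/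
theorem tb_xor (m n i : ℕ) : tb (m ^^^ n) i = (tb m i ^^ tb n i) := by
  simp only [tb_eq_testBit, Nat.testBit_xor]

/-- **Meaning of the disjointness test**: `disjB m n ↔` no common member. [folklore] -/
theorem disjB_eq_true_iff (m n : ℕ) : disjB m n = true ↔ ∀ i, ¬(tb m i = true ∧ tb n i = true) := by
  rw [disjB, Nat.beq_eq]
  constructor
  · intro h i ⟨hm, hn⟩
    have hb : (m &&& n).testBit i = false := by rw [h]; exact Nat.zero_testBit i
    rw [Nat.testBit_and] at hb
    rw [tb_eq_testBit] at hm hn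
    rw [hm, hn] at hb
    exact Bool.noConfusion hb
  · intro h
    apply Nat.eq_of_testBit_eq
    intro i
    rw [Nat.zero_testBit, Nat.testBit_and]
    have hi := h i
    rw [tb_eq_testBit, tb_eq_testBit] at hi
    rcases hm : m.testBit i with _ | _
    · rfl
    · rcases hn : n.testBit i with _ | _
      · rfl
      · exact absurd ⟨hm, hn⟩ hi

/-- The full mask is `2^p − 1`. [folklore] -/
theorem fullMask_eq (p : ℕ) : fullMask p = 2 ^ p - 1 := by
  rw [fullMask, Nat.one_shiftLeft]

/-- **Meaning of the full mask**: bit `i` is set iff `i < p`. [folklore] -/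
theorem tb_fullMask (p i : ℕ) : tb (fullMask p) i = decide (i < p) := by
  rw [tb_eq_testBit, fullMask_eq, Nat.testBit_two_pow_sub_one]

/-- **Complement inside `ℤ/p`**: for `i < p`, bit `i` of `fullMask p XOR m` is the negation of bit `i` of `m`. [folklore] -/
theorem tb_compl {p m i : ℕ} (hi : i < p) : tb (fullMask p ^^^ m) i = !(tb m i) := by
  rw [tb_xor, tb_fullMask, decide_eq_true hi, Bool.true_xor]

/-- Outside the low `p` bits a number `< 2^p` has no bits. [folklore] -/
theorem tb_eq_false_of_lt {p m i : ℕ} (hm : m < 2 ^ p) (hi : p ≤ i) : tb m i = false := by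
  rw [tb_eq_testBit]
  exact Nat.testBit_lt_two_pow (lt_of_lt_of_le hm (Nat.pow_le_pow_right (by norm_num) hi))

/-- **Meaning of `rot`**: for `m < 2^p`, `q ≤ p` and `i < p`, bit `i` of `rot p m q` is bit `(i + p − q) mod p` of `m` — i.e. `rot p m q` is the translate
`m + q` of the subset `m ⊆ ℤ/p`. [folklore] -/
theorem tb_rot {p m q i : ℕ} (hm : m < 2 ^ p) (hq : q ≤ p) (hi : i < p) : tb (rot p m q) i = tb m ((i + p - q) % p) := by
  rw [rot, tb_land, tb_lor, tb_fullMask, decide_eq_true hi, Bool.and_true, tb_eq_testBit, tb_eq_testBit, tb_eq_testBit,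
    Nat.testBit_shiftLeft, Nat.testBit_shiftRight]
  by_cases hiq : q ≤ i
  · rw [decide_eq_true hiq, Bool.true_and]
    have h2 : m.testBit (p - q + i) = false :=
      Nat.testBit_lt_two_pow (lt_of_lt_of_le hm (Nat.pow_le_pow_right (by norm_num) (by omega)))
    rw [h2, Bool.or_false, show i + p - q = (i - q) + p by omega, Nat.add_mod_right, Nat.mod_eq_of_lt (by omega)]
  · rw [show decide (i ≥ q) = false from decide_eq_false (by omega), Bool.false_and, Bool.false_or,
      Nat.mod_eq_of_lt (by omega), show p - q + i = i + p - q by omega]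

/-- `rot p m q < 2^p`. [folklore] -/
theorem rot_lt_two_pow (p m q : ℕ) : rot p m q < 2 ^ p := by
  refine Nat.lt_pow_two_of_testBit _ fun i hi => ?_
  have h := tb_land ((m <<< q) ||| (m >>> (p - q))) (fullMask p) i
  rw [tb_fullMask, show decide (i < p) = false from decide_eq_false (by omega), Bool.and_false, tb_eq_testBit] at h
  exact h

/-- Folding a conditional counter counts the filter. [folklore] -/
theorem foldl_cond_count {α : Type*} (f : α → Bool) (l : List α) (k : ℕ) :
    l.foldl (fun n i => cond (f i) (n + 1) n) k = k + (l.filter f).length := by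
  induction l generalizing k with
  | nil => simp
  | cons a l ih =>
    rw [List.foldl_cons, ih, List.filter_cons]
    cases f a <;> simp; omega

/-- **Meaning of `popc`**: the number of members among `is`. [folklore] -/
theorem popc_eq_length_filter (is : List ℕ) (m : ℕ) : popc is m = (is.filter fun i => tb m i).length := by
  rw [popc, foldl_cond_count, zero_add]

/-- `popc` is the length of `members`. [folklore] -/
theorem popc_eq_length_members (is : List ℕ) (m : ℕ) : popc is m = (members is m).length := by
  rw [popc_eq_length_filter, members]

/-- **Meaning of `members`**. [folklore] -/
theorem mem_members {is : List ℕ} {m i : ℕ} : i ∈ members is m ↔ i ∈ is ∧ tb m i = true := by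
  rw [members, List.mem_filter]

/-- `members` of a duplicate-free position list is duplicate-free. [folklore] -/
theorem nodup_members {is : List ℕ} (h : is.Nodup) (m : ℕ) : (members is m).Nodup := h.filter _

/-- **Round trip**: the members of `maskOf l` among `List.range p` are exactly the elements of `l` (all `< p`). [folklore] -/
theorem mem_members_maskOf {l : List ℕ} {p : ℕ} (h : ∀ x ∈ l, x < p) {i : ℕ} : i ∈ members (List.range p) (maskOf l) ↔ i ∈ l := by
  rw [mem_members, tb_maskOf, List.mem_range]
  exact ⟨fun h' => h'.2, fun h' => ⟨h i h', h'⟩⟩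

end Summit.MatrixMultiplication.OmegaCensus.CubeNB.Bits
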